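import Literature.Probability.LatticeModels.LatticeInterface
import HarnessLib

/-!
# Sheffield's exploration tree of site percolation on the triangular lattice: the branch to a
# target and its winding

Definition file (request `defn-PercolationExplorationTreeWinding`, route CriticalPhenomena/
CardyFormulaZ2/CardyWindingIG, cruxes `WindingFieldGFF` stmt-CriticalPhenomena-6831 and
`BranchWindingNormalisation` stmt-CriticalPhenomena-6917) — the **triangular-lattice half**
("same construction on `δ𝕋`, hexagonal exploration, turns `±π/3`", used by the calibration half of
stmt-6917). The `ℤ²`-medial half is NOT in this file (see the module docstring's last section).

## Sheffield's definition (verbatim, Duke Math. J. 147 (2009) = arXiv:math/0609167, §2.1)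

"Let `𝓗` be the infinite hexagonal lattice … A graph `G` consisting of the edges and vertices
incident to a finite simply connected subset of the hexagonal faces of `𝓗` is called a hexagon
graph. Let `F`, `E`, `V` denote the sets of faces, edges, vertices of `G`. Let `A ⊆ F` (black
hexagons; the members of `F ∖ A` and, unless otherwise stated, the hexagons outside `F`, are
white). Fix a vertex `v₀` on the outer boundary of `G` … and a directed edge `e₀` outside of `G`,
beginning at some vertex `v₋₁` and pointing towards `v₀`. For each vertex `v` of `G`, the
exploration path `T_v(A)` is a directed, non-self-intersecting path `v₀, v₁, v₂, …` that ends at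
`v`. Each `v_k`, `k ≥ 1`, is chosen in such a way that the sequence `v_{k-2}, v_{k-1}, v_k`
describes a RIGHT turn when the directed edge `(v_{k-2}, v_{k-1})` points to a black face and a
LEFT turn if `(v_{k-2}, v_{k-1})` points to a white face, unless this choice of `v_k` would fail to
lie in the same connected component of `V ∖ {v₀, …, v_{k-1}}` as `v`, in which case the path turns
the other direction. The exploration tree `T(A)` is the union over all `v ∈ V` of `T_v(A)`" — the
depth-first search tree of `G` from `v₀`, "right first after tracing an edge directed towards a
black face and left first after … a white face"; with Dobrushin colours of the outside faces the
branch to a boundary vertex is the chordal percolation interface (ibid., Prop. 2.4).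

## Transcription to the tree's objects (`TriangularLattice.lean`, `LatticeInterface.lean`)

Hexagons = sites of `𝕋` (`Site 2`); honeycomb vertices = faces of `𝕋` (`HexVertex`, vertex sets
`hexFaceVertices`); honeycomb edges = pairs of faces sharing an edge of `𝕋` (`hexGraph`). For
discrete Dobrushin data `E : DiscreteDobrushin` and a configuration `ω`:
* `F = Ω_δ = triMeshDomain E.Ω E.δ`; `V` = faces with a vertex in `F`; an edge of `hexGraph` is in
  `G` iff its crossed `𝕋`-edge has an endpoint in `F` (`triTreeAdj`);
* black = OPEN under the boundary condition and inside `Ω_δ` (`triTreeBlack`: `E.bcConfig ω` on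
  `Ω_δ` — arc `A` open, arc `B` closed —, white outside `Ω_δ`);
* the directed edge `f → g` "points to" the hexagon AHEAD, the vertex of `g` off the crossed edge
  (`triAhead`; Schramm–Sheffield's "vertex not on the edge containing `η_n`");
* RIGHT/LEFT exits of `g` entered from `f` (`triTurnFace f g right?`): with `ℓ`, `r` the left /
  right endpoints of the crossed edge (`ℓ + R(r - ℓ) = ahead`, `R = triRot60`, the convention of
  `triEdgeFaces`), the right turn leaves through the `𝕋`-edge `{ahead, r}`, the left turn through
  `{ℓ, ahead}` (turns by `∓π/3`);
* root: `e₀ = (v₋₁, v₀)` is the first dart `(f₀, f₁)` of the chordal exploration of the EMPTY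
  configuration, `explorationWalk E ∅` (forced by the arcs, hence configuration-independent for
  admissible `E`): `v₋₁ = f₀` the outer `A`–`B` face, `v₀ = f₁`; `f₀` is excluded from the search
  like Sheffield's outside vertex `v₋₁`.
`triExplorationBranch E ω z` runs the rule with fuel `#V + 1 ≤ 6 #F + 7` (each step visits a new
vertex) and returns `[v₀, v₁, …]`, stopping at `z`; junk values (documented): `[]` if the root dart
does not exist, and the path traced so far if neither exit is admissible (never for `z ∈ V`
reachable, by Sheffield's "the reader may check that `T(A)` is an out-directed spanning tree").
`triBranchTurnSigns` records `-1` (right) / `+1` (left) at `v₀, v₁, …` (the turn at `v₀` is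
relative to `e₀`), and `triBranchWinding E ω z = (π/3) · Σ signs` is the winding of the branch's
polyline (every honeycomb turn is `±π/3`; cf. `ExplorationWinding.turnOf`, `±π/2` on `ℤ²`).

## Not here: the `ℤ²`-medial half

On the medial lattice of `ℤ²` (4-regular) the exploration path is edge-simple but may TOUCH itself
at medial vertices (`IsMedialExploration.nodup` is on medial edges), so Sheffield's "same connected
component of `V ∖ {v₀, …, v_{k-1}}`" (a trivalent, vertex-simple notion) needs a non-crossing
refinement (which pairs of unexplored medial edges at a touched vertex are still connected) that
the request does not specify; it is left to the route's planner (see the work-item note).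

## References

* S. Sheffield, *Exploration trees and conformal loop ensembles*, Duke Math. J. 147 (2009)
  79–129 = arXiv:math/0609167, §2.1 (pp. 5–6 of the arXiv text), Prop. 2.4. [Sheffield2009]
* O. Schramm, S. Sheffield, Ann. Probab. 33 (2005), §2 (the vertex "not on the edge").
  [SchrammSheffield2005]
* S. Smirnov, C. R. Acad. Sci. 333 (2001), §2 (hexagonal exploration). [Smirnov2001]
-/

noncomputable section

open Finset

namespace Literature.Probability.LatticeModels

variable (E : DiscreteDobrushin)

/-! ### The hexagon graph of the discrete domain and its colouring -/

/-- The vertex set `V` of Sheffield's hexagon graph `G` of `F = Ω_δ`: faces of `𝕋` (honeycomb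
vertices) having a vertex in `Ω_δ`. [cite: Sheffield2009, §2.1 (hexagon graph)] -/
def triTreeVertices : Set HexVertex :=
  {f | ∃ x ∈ hexFaceVertices f, x ∈ triMeshDomain E.Ω E.δ}

/-- Adjacency in Sheffield's hexagon graph `G` of `F = Ω_δ`: two faces of `𝕋` sharing a
`𝕋`-edge (`hexGraph`) one of whose endpoints is a hexagon of `F` (the honeycomb edge is a side of
a hexagon of `F`). [cite: Sheffield2009, §2.1 (hexagon graph)] -/
def triTreeAdj (f g : HexVertex) : Prop :=
  hexGraph.Adj f g ∧ ∃ x ∈ hexFaceVertices f ∩ hexFaceVertices g, x ∈ triMeshDomain E.Ω E.δ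

/-- The colouring read by the exploration tree: a hexagon is BLACK iff it lies in `Ω_δ` and is
open under the Dobrushin boundary condition (`E.bcConfig ω`: arc `A` open, arc `B` closed);
hexagons outside `Ω_δ` are white ("we will also refer to the hexagons of `𝓗` outside of `F` as
white"). [cite: Sheffield2009, §2.1] -/
def triTreeBlack (ω : Percolation.SiteConfig (Site 2)) (x : Site 2) : Prop :=
  x ∈ triMeshDomain E.Ω E.δ ∧ x ∈ E.bcConfig ω

variable {E}

/-! ### Local geometry of a honeycomb dart -/

open scoped Classical in
/-- The hexagon AHEAD of the honeycomb dart `f → g` (the face the directed edge "points to"): the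
vertex of `g` off the crossed edge `hexFaceVertices f ∩ hexFaceVertices g`; junk `g.1` if `f`, `g`
are not adjacent. [cite: Sheffield2009, §2.1 ("points to a black face")] -/
def triAhead (f g : HexVertex) : Site 2 :=
  if h : ∃ v : Site 2, hexFaceVertices g \ hexFaceVertices f = {v} then h.choose else g.1

open scoped Classical in
/-- The (left, right) endpoints of the `𝕋`-edge crossed by the honeycomb dart `f → g`, in the
orientation convention of `triEdgeFaces` (`g` is the LEFT face of the dart `ℓ → r` of `𝕋`, i.e.
`ℓ + R (r - ℓ)` is the vertex ahead, `R = triRot60`); junk `(g.1, g.1)` off adjacent pairs.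
[cite: Sheffield2009, §2.1] -/
def triCrossedEdge (f g : HexVertex) : Site 2 × Site 2 :=
  if h : ∃ p : Site 2 × Site 2, p.1 ≠ p.2 ∧ p.1 ∈ hexFaceVertices f ∩ hexFaceVertices g ∧
      p.2 ∈ hexFaceVertices f ∩ hexFaceVertices g ∧ p.1 + triRot60 (p.2 - p.1) = triAhead f g
  then h.choose else (g.1, g.1)

/-- The face of `𝕋` across the edge `{a, b}` from the face with third vertex `c`: its third vertex
is the other apex `a + R^{±1}(b - a)`. [cite: Sheffield2009, §2.1] -/
def triFaceAcross (a b c : Site 2) : HexVertex :=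
  let t₁ := a + triRot60 (b - a)
  let t₂ := a + triRotNeg60 (b - a)
  triFace a b (if t₁ = c then t₂ else t₁)

/-- The exit face of the RIGHT (`right = true`, through the `𝕋`-edge `{ahead, r}`, a turn by
`-π/3`) resp. LEFT (`{ℓ, ahead}`, `+π/3`) turn at `g` entered from `f`. [cite: Sheffield2009, §2.1 (right/left turn)] -/
def triTurnFace (f g : HexVertex) (right : Bool) : HexVertex :=
  let a := triAhead f g
  let e := triCrossedEdge f g
  if right then triFaceAcross a e.2 e.1 else triFaceAcross e.1 a e.2

/-! ### The branch of the exploration tree to a target -/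

open scoped Classical in
/-- One choice of Sheffield's rule at the current vertex `g` entered from `f`, heading for the
target `z`, with `visited` the vertices used so far (and the outside root vertex): the PREFERRED
exit is the right turn if the hexagon ahead is black, the left turn if white; an exit is
admissible iff it is a `G`-neighbour, unvisited, and in the connected component of `z` in `G`
minus the visited vertices; take the preferred exit if admissible, else the other one if
admissible, else `none`. Returns the exit face and whether it was a right turn. [cite: Sheffield2009, §2.1] -/
def triTreeNext (ω : Percolation.SiteConfig (Site 2)) (z : HexVertex) (visited : List HexVertex)
    (f g : HexVertex) : Option (HexVertex × Bool) :=
  let free : SimpleGraph HexVertex :=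
    SimpleGraph.fromRel fun u w => triTreeAdj E u w ∧ u ∉ visited ∧ w ∉ visited
  let admissible : HexVertex → Prop := fun w =>
    triTreeAdj E g w ∧ w ∉ visited ∧ free.Reachable w z
  let pref : Bool := if triTreeBlack E ω (triAhead f g) then true else false
  let w₁ := triTurnFace f g pref
  let w₂ := triTurnFace f g (!pref)
  if admissible w₁ then some (w₁, pref) else if admissible w₂ then some (w₂, !pref) else none

/-- The fuelled run of Sheffield's rule: from the dart `f → g` with `visited` (containing `g` and
`f`), produce the list of (vertex, right?) pairs appended after `g` until `z` is reached, no exit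
is admissible, or the fuel is exhausted. [cite: Sheffield2009, §2.1] -/
def triTreeRun (ω : Percolation.SiteConfig (Site 2)) (z : HexVertex) :
    ℕ → List HexVertex → HexVertex → HexVertex → List (HexVertex × Bool)
  | 0, _, _, _ => []
  | n + 1, visited, f, g =>
    if g = z then []
    else
      match triTreeNext (E := E) ω z visited f g with
      | none => []
      | some (w, b) => (w, b) :: triTreeRun ω z n (w :: visited) g w

open scoped Classical in
/-- The root dart `e₀ = (v₋₁, v₀)` of the exploration tree of `E`: the first dart `(f₀, f₁)` of the
chordal exploration of the empty configuration (`explorationWalk E ∅`; forced by the arcs), if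
any. [cite: Sheffield2009, §2.1 (the directed edge e₀ pointing towards v₀)] -/
def triTreeRoot (E : DiscreteDobrushin) : Option (HexVertex × HexVertex) :=
  match explorationWalk E ∅ with
  | none => none
  | some γ =>
    match γ.2.2.darts with
    | [] => none
    | d :: _ => some (d.fst, d.snd)

open scoped Classical in
/-- The fuel: one more than a bound `6 #F + 6` for `#V` (every face with a vertex in `F` is one of
the six faces at that vertex); `0`-based junk when `Ω_δ` is infinite (`ncard = 0`). [cite: Sheffield2009, §2.1] -/
def triTreeFuel (E : DiscreteDobrushin) : ℕ := 6 * (triMeshDomain E.Ω E.δ).ncard + 7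

/-- **The branch `T_z` of Sheffield's exploration tree** of the colouring `ω` (with Dobrushin
boundary condition) in the hexagon graph of `Ω_δ`, from the root `v₀` to the target `z`, as the
vertex list `[v₀, v₁, …]` (ending at `z` when `z` is reached; the turns made along the way are
`triBranchTurnSigns`). Junk `[]` without a root dart.
[cite: Sheffield2009, §2.1 (exploration path T_v(A))] -/
def triExplorationBranch (E : DiscreteDobrushin) (ω : Percolation.SiteConfig (Site 2))
    (z : HexVertex) : List HexVertex :=
  match triTreeRoot E with
  | none => []
  | some (f₀, f₁) => f₁ :: (triTreeRun (E := E) ω z (triTreeFuel E) [f₁, f₀] f₀ f₁).map Prod.fst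

/-- The turn signs along the branch to `z`: `-1` for a right turn (by `-π/3`), `+1` for a left turn
(`+π/3`), at `v₀` (relative to the root dart `e₀`), `v₁`, …, i.e. one sign per step taken.
[cite: Sheffield2009, §2.1] -/
def triBranchTurnSigns (E : DiscreteDobrushin) (ω : Percolation.SiteConfig (Site 2))
    (z : HexVertex) : List ℤ :=
  match triTreeRoot E with
  | none => []
  | some (f₀, f₁) =>
    (triTreeRun (E := E) ω z (triTreeFuel E) [f₁, f₀] f₀ f₁).map fun q => if q.2 then -1 else 1

/-- **The winding of the branch to `z`**: `(π/3) · Σ (turn signs)`, the total turning of the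
polyline through the centres of `v₋₁, v₀, v₁, …, z` (every step of a honeycomb path turns by
`±π/3`; on `ℤ²` the analogous closed form is `ExplorationWinding.sum_turnOf_eq` with `±π/2`).
This is the route's winding field `h(z)` read at the vertex `z` of the tree. [cite: Sheffield2009, §2.1] -/
def triBranchWinding (E : DiscreteDobrushin) (ω : Percolation.SiteConfig (Site 2))
    (z : HexVertex) : ℝ :=
  Real.pi / 3 * (((triBranchTurnSigns E ω z).map fun s : ℤ => (s : ℝ)).sum)

/-! ### API -/

/-- The run has at most `fuel` steps. [cite: Sheffield2009, §2.1] -/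
theorem length_triTreeRun_le (ω : Percolation.SiteConfig (Site 2)) (z : HexVertex) :
    ∀ (n : ℕ) (visited : List HexVertex) (f g : HexVertex),
      (triTreeRun (E := E) ω z n visited f g).length ≤ n
  | 0, _, _, _ => by simp [triTreeRun]
  | n + 1, visited, f, g => by
    rw [triTreeRun]
    split_ifs
    · simp
    · split
      · simp
      · simpa using length_triTreeRun_le ω z n _ _ _

/-- At the target the run stops at once. [cite: Sheffield2009, §2.1] -/
@[simp] theorem triTreeRun_self (ω : Percolation.SiteConfig (Site 2)) (z : HexVertex) (n : ℕ)
    (visited : List HexVertex) (f : HexVertex) :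
    triTreeRun (E := E) ω z n visited f z = [] := by
  cases n <;> simp [triTreeRun]

/-- One turn sign per step: the sign list and the branch have lengths differing by the root.
[cite: Sheffield2009, §2.1] -/
theorem length_triExplorationBranch (ω : Percolation.SiteConfig (Site 2)) (z : HexVertex)
    (h : (triTreeRoot E).isSome) :
    (triExplorationBranch E ω z).length = (triBranchTurnSigns E ω z).length + 1 := by
  unfold triExplorationBranch triBranchTurnSigns
  rcases hr : triTreeRoot E with _ | ⟨f₀, f₁⟩
  · simp [hr] at h
  · simp

/-- Without a root dart the branch is the junk `[]`. [cite: Sheffield2009, §2.1] -/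
theorem triExplorationBranch_of_triTreeRoot_eq_none {ω : Percolation.SiteConfig (Site 2)}
    {z : HexVertex} (h : triTreeRoot E = none) : triExplorationBranch E ω z = [] := by
  simp [triExplorationBranch, h]

/-- Without a root dart the winding is `0`. [cite: Sheffield2009, §2.1] -/
theorem triBranchWinding_of_triTreeRoot_eq_none {ω : Percolation.SiteConfig (Site 2)}
    {z : HexVertex} (h : triTreeRoot E = none) : triBranchWinding E ω z = 0 := by
  simp [triBranchWinding, triBranchTurnSigns, h]

/-- The branch to the root itself is `[v₀]` (no step). [cite: Sheffield2009, §2.1] -/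
theorem triExplorationBranch_root {ω : Percolation.SiteConfig (Site 2)} {f₀ f₁ : HexVertex}
    (h : triTreeRoot E = some (f₀, f₁)) : triExplorationBranch E ω f₁ = [f₁] := by
  simp [triExplorationBranch, h]

/-- The winding is `π/3` times an integer (the signed turn count). [cite: Sheffield2009, §2.1] -/
theorem triBranchWinding_eq (ω : Percolation.SiteConfig (Site 2)) (z : HexVertex) :
    triBranchWinding E ω z = Real.pi / 3 * (((triBranchTurnSigns E ω z).sum : ℤ) : ℝ) := by
  rw [triBranchWinding, Int.cast_list_sum]

end Literature.Probability.LatticeModels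

end
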